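import Summits.QuantumFields.YangMills.Theorems.BalabanUVNodesPortS1FEStepReg
import Summits.QuantumFields.YangMills.Theorems.BalabanUVNodesK0RecordFormatNamesP0CGuardedL

/-!
# NODE O port PT-A — TWO PRINT-SHAPED LETTERS FOR THE ε₀-CLASS EDITION OF THE LZ HALF (★★★ director-ym №627 (1)): `ClassP2Reg F` — the (P2) agreement of the P0-ℂ carrier with the
# preconditioned matrix AT EVERY POINT OF ONE ε₀-REGULAR CLASS (the germ row `P0CarrierClauses` :108 widened, quantifier order of `PortRecordLZHalfReg`), and `BgFieldAnalyticOnClass F` —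
# real-analyticity of the rooted background `B ↦ U_{k+1}(W_B)` on an open set joining the class to `0` (the identity-theorem input of hand-27930-LZReg-1's `classP2Reg_of_bgAnalyticOnClass`)

Cell `ym-nodeO-ideate`, porter seat PT-A-1 (gen 10); `--supports stmt-QuantumFields-27930 --as helper`; count-neutral; definition kind (two `def … : Prop`, nothing else).
[I] = [Balaban1987RG1]; [15] = [Balaban1985Variational].

WHY (located, ✓`…PortS1FEStepReg` :140 ∕ ✓`…K0RecordFormatNamesP0C` :107–:113 ∕ this seat's bus lines 18:06Z–18:08Z, ★★★ №627).  v3.7's `stub_LZhalfReg : ∀ F, PortRecordLZHalfReg F` needs the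
wrap-aware residue of `phiLZ` AT EVERY chart point `B` with `InRegClass F Mc k ε₀ a₀ ε₂₉ n B` for ONE `ε₀ > 0` uniform in `k` (`∃ … δ₀ …, ∀ k, LZResidueRegAt … δ₀ … k`, the `δ₀` slot of
`LZResidueRegAt` being the class radius).  Every row of the P0-ℂ letter's body `P0CarrierClauses` is class-blind (quantified over all pairs ∕ over `recordUc … α₀ α₁`) EXCEPT (P2), which is a GERM
(`∀ n, ∀ᶠ B in 𝓝 0, TC n (recordPairJ … B) = ↑(recordPreckLoc … (portVkAx … B) …)` on `NonB0Idx`; NB its `δ₀` is the Schur DECAY RATE, not a class radius).  `ClassP2Reg` is that row on the class;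
`BgFieldAnalyticOnClass` is what an identity-theorem proof of it needs from P0-ℝ (⁸'s `hP9` and ⟨26900⟩'s `stub_bgFieldAnalyticAtRecord` are `AnalyticAt … 0` only).

WHAT THIS FILE IS.  §1 `ClassP2Reg` (consumed by PT-A's g11 brick `lzHalfReg_of_P0C_of_classP2 : (∀F, P0HolExtAtRecordGL F) → (∀F, ClassP2Reg F) → … → ∀F, PortRecordLZHalfReg F`; quantifier
order: `ε₀` is chosen AFTER `(Mc, a₀, ε₂₉)` and the P0 constants `(δ₀, c₀, γ₀, γ₁, α₀, α₁)` — all fixed before `∀ k` in `P0HolExtAtRecordGL` ∕ `PortRecordLZHalfReg` — and BEFORE `k`, `n`, the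
carriers and `B`, exactly what `∃ … δ₀, ∀ k, LZResidueRegAt … δ₀ … k` consumes).  §2 `BgFieldAnalyticOnClass` (the hand's hypothesis; `ε₀` before `k n`; per `(k, n)` an open set `S ∋ 0`, the
class inside the connected component of `0` in `S`, `AnalyticOnNhd ℝ` of the matrix entries of `recordBgField` on `S`).

HONEST FRAMING.  Two `Prop`s, asserted for nothing, inhabited nowhere; whether `BgFieldAnalyticOnClass` is print verbatim ([15] Thm 1 analyticity of the minimiser on (1.1)'s domain,
transported to the chart `B ↦ W_B`) or the honest displayed residual of the LZ half is the hand's one line (№627 (3)); the connectivity clause is part of the letter ON PURPOSE (the class is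
unbounded in the gauge directions of `B`, so no polydisc contains it; the identity theorem needs a connected analyticity region joining `0` to each class point).  `PortRecordLZHalfReg` ∕
`P0HolExtAtRecordGL` ∕ `FEStepReg` inhabited NOWHERE; `stub_P0C`∕`stub_LZhalfReg`∕`stub_FEstepReg` OPEN; ⟨27930⟩ OPEN 1∕4; ⟨26900⟩ 0∕4; NODE O 0∕1; COUNT 8∕28 · K 1∕4 UNMOVED; finite `𝕋⁴_{L^K}`
at fixed ε — NOT continuum ∕ OS; **the Yang–Mills mass gap (Clay) is NOT proved by any of this.**  No `sorry`, no `instance`, no theorem; standard axioms.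
-/

noncomputable section

open scoped BigOperators Matrix.Norms.L2Operator Topology
open Filter Set

namespace Summit.QuantumFields.YangMills.Theorems.BalabanUVNodesPortS1

open Summit.QuantumFields.YangMills.Theorems.K0RecordFormatNames
open Literature.MathematicalPhysics.QuantumFieldTheory.Balaban1983to89
open Literature.MathematicalPhysics.QuantumFieldTheory.Balaban1983to89.Node00
open Literature.MathematicalPhysics.QuantumFieldTheory.Balaban1983to89.T4Continuum (T4Family)

/-! ## §1  The (P2) agreement on the ε₀-regular class -/

/-- ★ **`ClassP2Reg F` — THE (P2) AGREEMENT OF THE P0-ℂ CARRIER WITH THE PRECONDITIONED MATRIX ON PRINT's CLASS**: for every admissible `Mc`, radii `a₀, ε₂₉ > 0` and P0 constants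
`(δ₀, c₀, γ₀, γ₁, α₀, α₁)` there is ONE class radius `ε₀ > 0`, uniform in `k`, `n` and in the carriers, such that for every carrier family with the P0-ℂ body at level `k` and every chart point `B`
of the ε₀-regular class (`InRegClass`: the level-`(k+1)` problem over `W_B` is solvable at radius `a₀` AND `U_{k+1}(W_B) ∈ U_{k+1}(ε₀)`), the total carrier read at the real pair of `U_{k+1}(W_B)` IS
`recordPreckLoc … (portVkAx … B) (hopLinGraph …)` on `NonB0Idx` — `P0CarrierClauses`' germ row (P2) at every class point; print's «(2.11)–(2.12) on U_k(ε₀)».  A `Prop`; asserted for nothing.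
[cite: Balaban1987RG1, (2.11)–(2.12) pp.267–268, (1.1)–(1.2) p.260, p.264 (Thm 3 «on the spaces U_k(ε₀)»); Balaban1985Variational, Prop. 9 p.309] -/
def ClassP2Reg (F : T4Family) : Prop :=
  ∀ (Mc : ℕ) (a₀ ε₂₉ δ₀ c₀ γ₀ γ₁ α₀ α₁ : ℝ), McGuard F Mc → 0 < a₀ → 0 < ε₂₉ →
    ∃ ε₀ : ℝ, 0 < ε₀ ∧ ∀ (k : ℕ) TC TY TZY AdM AdZ, P0CarrierClauses F a₀ δ₀ c₀ γ₀ γ₁ Mc α₀ α₁ ε₂₉ k TC TY TZY AdM AdZ →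
      ∀ (n : ℕ) (B : recordW F a₀ ε₂₉ k (recordK₀ F Mc k + n)), InRegClass F Mc k ε₀ a₀ ε₂₉ n B →
        letI θ := thetaFill F a₀ ε₂₉; letI := θ.instVβ₁; letI := θ.instVβ₂; letI := θ.instιβ
        ∀ i j : NonB0Idx F k (recordK₀ F Mc k + n),
          TC n (recordPairJ F θ k (recordK₀ F Mc k + n) B) i.1 j.1 =
            ((recordPreckLoc F k (recordK₀ F Mc k + n) a₀ (portVkAx F a₀ ε₂₉ k (recordK₀ F Mc k + n) B)
              (hopLinGraph F k (recordK₀ F Mc k + n) (portVkAx F a₀ ε₂₉ k (recordK₀ F Mc k + n) B)) i j : ℝ) : ℂ)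

/-! ## §2  Real-analyticity of the rooted background on a region joining the class to `0` -/

/-- ★ **`BgFieldAnalyticOnClass F` — THE ROOTED BACKGROUND IS REAL-ANALYTIC ON AN OPEN REGION JOINING THE ε₀-CLASS TO `0`**: for every admissible `Mc` and radii `a₀, ε₂₉ > 0` there is ONE
`ε₀ > 0`, uniform in `k` and `n`, and at every `(k, n)` an open set `S ∋ 0` of chart points, every point of the ε₀-regular class lying in the connected component of `0` in `S`, on which the matrix
entries of `B ↦ U_{k+1}(W_B) = recordBgField …` are `AnalyticOnNhd ℝ` — [15] Thm 1's analytic dependence of the minimiser on the bond variables over (1.1)'s domain, read in the chart `B ↦ W_B`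
(the connectivity clause is displayed because the class is unbounded in the gauge directions of `B`: no polydisc contains it).  A `Prop`; asserted for nothing; the identity-theorem input of
`classP2Reg_of_bgAnalyticOnClass` (hand-27930-LZReg-1). [cite: Balaban1985Variational, Thm 1 p.279, Prop. 9 p.309, (117) p.295; Balaban1987RG1, (1.1)–(1.2) p.260, (0.21) p.256] -/
def BgFieldAnalyticOnClass (F : T4Family) : Prop :=
  ∀ (Mc : ℕ) (a₀ ε₂₉ : ℝ), McGuard F Mc → 0 < a₀ → 0 < ε₂₉ →
    ∃ ε₀ : ℝ, 0 < ε₀ ∧ ∀ (k n : ℕ),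
      letI θ := thetaFill F a₀ ε₂₉; letI := θ.instVβ₁; letI := θ.instVβ₂; letI := θ.instιβ
      ∃ S : Set (recordW F a₀ ε₂₉ k (recordK₀ F Mc k + n)), IsOpen S ∧ (0 : recordW F a₀ ε₂₉ k (recordK₀ F Mc k + n)) ∈ S ∧
        (∀ B : recordW F a₀ ε₂₉ k (recordK₀ F Mc k + n), InRegClass F Mc k ε₀ a₀ ε₂₉ n B → B ∈ connectedComponentIn S (0 : recordW F a₀ ε₂₉ k (recordK₀ F Mc k + n))) ∧
        AnalyticOnNhd ℝ (fun B : recordW F a₀ ε₂₉ k (recordK₀ F Mc k + n) => fun (b : PBond (F.P (recordK₀ F Mc k + n)) 0) (i i' : Fin 2) =>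
          ((recordBgField F θ k (recordK₀ F Mc k + n) B b : SU 2) : Matrix (Fin 2) (Fin 2) ℂ) i i') S

end Summit.QuantumFields.YangMills.Theorems.BalabanUVNodesPortS1

end
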